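import Mathlib
import Literature.Probability.Percolation.DiagonalStripVertexResidueSums
import HarnessLib

/-!
# The numerators of Hagendorf–Liénardy's integral solution and the exchange relations

Topic `Literature/Probability/Percolation`. Hagendorf–Liénardy (J. Stat. Mech. (2021) 013104,
arXiv:2008.03220, §3.1–3.2) define, for down-spin positions `a_1 < ⋯ < a_n` on `L` sites, the
multiple contour integral (their (3.1)–(3.2))
`Ψ_a = (-[q])ⁿ ∏_{i<j} [q z_j/z_i][q² z_i z_j] ∮⋯∮ ∏ dw_ℓ/(πi w_ℓ) Ξ_a(w | z)` and prove the six-vertex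
exchange relations by four cases (Prop. 3.2). Here the integral is the residue sum `resSum` of
`DiagonalStripVertexResidueSums` (contours around the `z_j` only; Cherednik parameter `β → 0`, so
that `∏ [β w_ℓ]` becomes `∏ w_ℓ⁻¹`), written with a numerator that is a product of brackets:
`Ξ_a ∏_ℓ ∏_j [z_j/w_ℓ] = N_a(w) = A(w) ∏_ℓ Ẽ_{a_ℓ}(w_ℓ) ∏_ℓ G(w_ℓ)` with
`A(w) = ∏_{ℓ<ℓ'} [c w_{ℓ'}/w_ℓ][w_ℓ/w_{ℓ'}][c w_ℓ w_{ℓ'}][c² w_ℓ w_{ℓ'}] ∏_ℓ [c² w_ℓ²] ∏_ℓ w_ℓ⁻¹`,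
`Ẽ_a(u) = ∏_{j>a} [z_j/u] ∏_{j<a} [c z_j/u]`, `G(u) = (∏_j [c z_j/u] ∏_j [c² u z_j])⁻¹` (`c = q`,
`[x] = x - x⁻¹`, sites `0, …, L-1`). We prove the four pointwise identities behind HL's four cases
(`vNum_case1`–`vNum_case4`: invariance, an antisymmetric difference, and the two three-term
identities `[c][z_t/u] + [z_s/z_t][c z_s/u] = [c z_s/z_t][z_s/u]`,
`[c][c z_s/u] + [z_s/z_t][z_t/u] = [c z_s/z_t][c z_t/u]`), and deduce the **exchange relations of
the components** `Ψ_a = [c]ⁿ · pref · resSum N_a` (`vPsi`):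
`[c z_t/z_s] σ_s Ψ_a = [c z_s/z_t] Ψ_a` when the sites `s, t = s+1` carry equal spins
(**`vPsi_exchange_same`**, HL (3.13)) and `[c] Ψ_a + [z_s/z_t] Ψ_{a'} = [c z_t/z_s] σ_s Ψ_a` when they
differ, `a'` being `a` with the spin at `s`/`t` moved to `t`/`s` (**`vPsi_exchange_move_right`**,
**`vPsi_exchange_move_left`**, HL (3.16)–(3.17)). No property of `q` is used except `q ≠ 0`.

## References

* C. Hagendorf, J. Liénardy, *The open XXZ chain at Δ = -1/2 and the boundary quantum
  Knizhnik–Zamolodchikov equations*, J. Stat. Mech. (2021) 013104, arXiv:2008.03220, §3.1–3.2,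
  Prop. 3.2. [HagendorfLienardy2021]
-/

noncomputable section

namespace Literature.Probability.Percolation

open Finset MvPolynomial Literature.Probability.LatticeModels.TemperleyLieb

variable {L n : ℕ}

/-! ### Bracket identities -/

section Brackets

variable {F : Type*} [Field F]

/-- `[u/w][c v/w'] - [v/w][c u/w'] = [u/v][c w/w']` (HL Prop. 3.2, Case 2). [cite: HagendorfLienardy2021, Prop. 3.2] -/
theorem qbr_case2 {c u v w w' : F} (hc : c ≠ 0) (hu : u ≠ 0) (hv : v ≠ 0) (hw : w ≠ 0) (hw' : w' ≠ 0) :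
    qbr (u / w) * qbr (c * v / w') - qbr (v / w) * qbr (c * u / w') = qbr (u / v) * qbr (c * w / w') := by
  unfold qbr; field_simp; ring

/-- `[c][v/u] + [s/v][c s/u] = [c s/v][s/u]` (HL Prop. 3.2, Case 3). [cite: HagendorfLienardy2021, Prop. 3.2] -/
theorem qbr_case3 {c s v u : F} (hc : c ≠ 0) (hs : s ≠ 0) (hv : v ≠ 0) (hu : u ≠ 0) :
    qbr c * qbr (v / u) + qbr (s / v) * qbr (c * s / u) = qbr (c * s / v) * qbr (s / u) := by
  unfold qbr; field_simp; ring

/-- `[c][c s/u] + [s/v][v/u] = [c s/v][c v/u]` (HL Prop. 3.2, Case 4). [cite: HagendorfLienardy2021, Prop. 3.2] -/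
theorem qbr_case4 {c s v u : F} (hc : c ≠ 0) (hs : s ≠ 0) (hv : v ≠ 0) (hu : u ≠ 0) :
    qbr c * qbr (c * s / u) + qbr (s / v) * qbr (v / u) = qbr (c * s / v) * qbr (c * v / u) := by
  unfold qbr; field_simp; ring

/-- `[b/a] = -[a/b]`. [folklore] -/
theorem qbr_div_rev (a b : F) : qbr (b / a) = -qbr (a / b) := by
  rw [← inv_div, qbr_inv]

/-- `c ≠ 0` in the rapidity field. [folklore] -/
theorem genC_ne_zero'' {a : ℂ} (ha : a ≠ 0) : genC ℂ a ≠ 0 := by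
  unfold genC
  exact (map_ne_zero_iff _ toRF_injective).2 (C_ne_zero.2 ha)

/-- `q² ≠ 1` at a primitive cube root of unity (characteristic `0`). [folklore] -/
theorem sq_ne_one_of_quad'' {q : ℂ} (hq : q ^ 2 + q + 1 = 0) : q ^ 2 ≠ 1 := by
  intro h; rw [h] at hq
  have : q = -2 := by linear_combination hq
  rw [this] at h; norm_num at h

end Brackets

/-! ### Ordered pairs and the adjacent transposition -/

section Pairs

/-- The ordered pairs `ℓ < ℓ'` of `Fin n`. [folklore] -/
def pairsLT (n : ℕ) : Finset (Fin n × Fin n) := univ.filter fun p => p.1 < p.2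

/-- Membership in `pairsLT`. [folklore] -/
@[simp] theorem mem_pairsLT {p : Fin n × Fin n} : p ∈ pairsLT n ↔ p.1 < p.2 := by
  simp [pairsLT]

variable {ℓ ℓ' : Fin n}

/-- An adjacent transposition preserves the order of every pair other than the transposed one.
[folklore] -/
theorem swap_lt_swap_iff (hℓ : ℓ'.val = ℓ.val + 1) {k k' : Fin n} (hkk : ¬(k = ℓ ∧ k' = ℓ'))
    (hkk' : ¬(k = ℓ' ∧ k' = ℓ)) : Equiv.swap ℓ ℓ' k < Equiv.swap ℓ ℓ' k' ↔ k < k' := by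
  rw [Equiv.swap_apply_def, Equiv.swap_apply_def]
  simp only [Fin.lt_def, Fin.ext_iff] at *
  split_ifs <;> omega

/-- The image of the pairs other than `(ℓ, ℓ+1)` under the adjacent transposition is itself.
[folklore] -/
theorem image_swap_pairsLT_erase (hℓ : ℓ'.val = ℓ.val + 1) :
    ((pairsLT n).erase (ℓ, ℓ')).image (fun p => (Equiv.swap ℓ ℓ' p.1, Equiv.swap ℓ ℓ' p.2)) =
      (pairsLT n).erase (ℓ, ℓ') := by
  have hne : ℓ ≠ ℓ' := fun h => by rw [h] at hℓ; omega
  have key : ∀ p : Fin n × Fin n, p ∈ (pairsLT n).erase (ℓ, ℓ') →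
      (Equiv.swap ℓ ℓ' p.1, Equiv.swap ℓ ℓ' p.2) ∈ (pairsLT n).erase (ℓ, ℓ') := by
    rintro ⟨k, k'⟩ hp
    rw [mem_erase, mem_pairsLT] at hp ⊢
    obtain ⟨hp1, hp2⟩ := hp
    have h1 : ¬(k = ℓ ∧ k' = ℓ') := fun h => hp1 (Prod.ext h.1 h.2)
    have h2 : ¬(k = ℓ' ∧ k' = ℓ) := by
      rintro ⟨rfl, rfl⟩; simp only [Fin.lt_def] at hp2; omega
    refine ⟨fun h => ?_, (swap_lt_swap_iff hℓ h1 h2).2 hp2⟩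
    simp only [Prod.mk.injEq] at h
    apply h2
    constructor
    · have := congrArg (Equiv.swap ℓ ℓ') h.1
      rwa [Equiv.swap_apply_self, Equiv.swap_apply_left] at this
    · have := congrArg (Equiv.swap ℓ ℓ') h.2
      rwa [Equiv.swap_apply_self, Equiv.swap_apply_right] at this
  apply Finset.Subset.antisymm
  · intro p hp
    obtain ⟨p', hp', rfl⟩ := mem_image.1 hp
    exact key p' hp'
  · intro p hp
    refine mem_image.2 ⟨(Equiv.swap ℓ ℓ' p.1, Equiv.swap ℓ ℓ' p.2), key p hp, ?_⟩
    simp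

/-- **Reindexing a product over ordered pairs by an adjacent transposition**: only the factor of
the transposed pair changes orientation. [folklore] -/
theorem prod_pairsLT_swap {M : Type*} [CommMonoid M] (hℓ : ℓ'.val = ℓ.val + 1) (f : Fin n → Fin n → M) :
    (∏ p ∈ pairsLT n, f (Equiv.swap ℓ ℓ' p.1) (Equiv.swap ℓ ℓ' p.2)) * f ℓ ℓ' =
      (∏ p ∈ pairsLT n, f p.1 p.2) * f ℓ' ℓ := by
  have hmem : (ℓ, ℓ') ∈ pairsLT n := by rw [mem_pairsLT]; simp [Fin.lt_def, hℓ]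
  rw [← mul_prod_erase _ _ hmem, ← mul_prod_erase _ _ hmem]
  simp only [Equiv.swap_apply_left, Equiv.swap_apply_right]
  have key : ∏ x ∈ (pairsLT n).erase (ℓ, ℓ'), f (Equiv.swap ℓ ℓ' x.1) (Equiv.swap ℓ ℓ' x.2) =
      ∏ x ∈ (pairsLT n).erase (ℓ, ℓ'), f x.1 x.2 := by
    calc ∏ x ∈ (pairsLT n).erase (ℓ, ℓ'), f (Equiv.swap ℓ ℓ' x.1) (Equiv.swap ℓ ℓ' x.2)
        = ∏ x ∈ ((pairsLT n).erase (ℓ, ℓ')).image (fun p => (Equiv.swap ℓ ℓ' p.1, Equiv.swap ℓ ℓ' p.2)), f x.1 x.2 := by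
          refine (prod_image (s := (pairsLT n).erase (ℓ, ℓ')) (f := fun x : Fin n × Fin n => f x.1 x.2)
            (g := fun p : Fin n × Fin n => (Equiv.swap ℓ ℓ' p.1, Equiv.swap ℓ ℓ' p.2)) ?_).symm
          rintro ⟨a, b⟩ _ ⟨a', b'⟩ _ h
          simp only [Prod.mk.injEq] at h ⊢
          exact ⟨(Equiv.swap ℓ ℓ').injective h.1, (Equiv.swap ℓ ℓ').injective h.2⟩
      _ = ∏ x ∈ (pairsLT n).erase (ℓ, ℓ'), f x.1 x.2 := by rw [image_swap_pairsLT_erase hℓ]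
  rw [key]
  simp only [mul_comm, mul_left_comm]

end Pairs

/-! ### The factors of the numerator -/

section Factors

variable (q : ℂ)

/-- The pair factor of `A`: `F(a, b) = [c b/a][a/b][c a b][c² a b]`. [cite: HagendorfLienardy2021, (3.2)] -/
def aPair (a b : RapidityField ℂ) : RapidityField ℂ :=
  qbr (genC ℂ q * b / a) * qbr (a / b) * qbr (genC ℂ q * a * b) * qbr (genC ℂ q ^ 2 * a * b)

/-- **`A(w)`**, the `z`-independent part of the numerator (with `∏ [β w_ℓ] ↦ ∏ w_ℓ⁻¹`, `β → 0`).
[cite: HagendorfLienardy2021, (3.2)] -/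
def aFac (w : Fin n → RapidityField ℂ) : RapidityField ℂ :=
  (∏ p ∈ pairsLT n, aPair q (w p.1) (w p.2)) * ((∏ k, qbr (genC ℂ q ^ 2 * w k * w k)) * ∏ k, (w k)⁻¹)

/-- **`Ẽ_a(u) = ∏_{j>a} [z_j/u] ∏_{j<a} [c z_j/u]`**: the position-dependent factor of the integration
variable sitting at the down spin `a` (HL's `1/(∏_{j≤a}[z_j/w] ∏_{j≥a}[q z_j/w])` over the universal
denominator). [cite: HagendorfLienardy2021, (3.2)] -/
def eT (z : Fin L → RapidityField ℂ) (a : Fin L) (u : RapidityField ℂ) : RapidityField ℂ :=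
  (∏ j ∈ univ.filter (fun j => a < j), qbr (z j / u)) * ∏ j ∈ univ.filter (fun j => j < a), qbr (genC ℂ q * z j / u)

/-- **`G(u) = (∏_j [c z_j/u] ∏_j [c² u z_j])⁻¹`**, the universal (position-independent, symmetric in
`z`) factor. [cite: HagendorfLienardy2021, (3.2)] -/
def gFac (z : Fin L → RapidityField ℂ) (u : RapidityField ℂ) : RapidityField ℂ :=
  ((∏ j, qbr (genC ℂ q * z j / u)) * ∏ j, qbr (genC ℂ q ^ 2 * u * z j))⁻¹

/-- **The numerator `N_a(w) = A(w) ∏_ℓ Ẽ_{a_ℓ}(w_ℓ) ∏_ℓ G(w_ℓ)`** for down spins at the sites `a_ℓ`.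
[cite: HagendorfLienardy2021, (3.2)] -/
def vNum (z : Fin L → RapidityField ℂ) (a : Fin n → Fin L) (w : Fin n → RapidityField ℂ) : RapidityField ℂ :=
  aFac q w * ((∏ ℓ, eT q z (a ℓ) (w ℓ)) * ∏ ℓ, gFac q z (w ℓ))

/-- **The prefactor `∏_{i<j} [c z_j/z_i][c² z_i z_j]`.** [cite: HagendorfLienardy2021, (3.1)] -/
def pref (z : Fin L → RapidityField ℂ) : RapidityField ℂ :=
  ∏ p ∈ pairsLT L, qbr (genC ℂ q * z p.2 / z p.1) * qbr (genC ℂ q ^ 2 * z p.1 * z p.2)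

/-- **The component `Ψ_a = [c]ⁿ · pref · resSum N_a`** of Hagendorf–Liénardy's vector (`β → 0`,
normalised by `βⁿ`; `a` lists the down spins). [cite: HagendorfLienardy2021, (3.1)] -/
def vPsi (L n : ℕ) (a : Fin n → Fin L) : RapidityField ℂ :=
  qbr (genC ℂ q) ^ n * pref q (zv (L := L)) * resSum L n (vNum q zv a)

end Factors

/-! ### Ring homomorphisms fixing `c` act argumentwise -/

section Map

variable {q : ℂ} {φ : RapidityField ℂ →+* RapidityField ℂ} (hφ : φ (genC ℂ q) = genC ℂ q)
include hφ

/-- `map_aPair` (technical). [folklore] -/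
theorem map_aPair (a b : RapidityField ℂ) : φ (aPair q a b) = aPair q (φ a) (φ b) := by
  simp only [aPair, map_mul, map_qbr, map_div₀, map_pow, hφ]

/-- `map_aFac` (technical). [folklore] -/
theorem map_aFac (w : Fin n → RapidityField ℂ) : φ (aFac q w) = aFac q (φ ∘ w) := by
  simp only [aFac, map_mul, map_prod, map_aPair hφ, map_qbr, map_pow, map_inv₀, hφ, Function.comp_apply]

/-- `map_eT` (technical). [folklore] -/
theorem map_eT (z : Fin L → RapidityField ℂ) (a : Fin L) (u : RapidityField ℂ) :
    φ (eT q z a u) = eT q (φ ∘ z) a (φ u) := by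
  simp only [eT, map_mul, map_prod, map_qbr, map_div₀, hφ, Function.comp_apply]

/-- `map_gFac` (technical). [folklore] -/
theorem map_gFac (z : Fin L → RapidityField ℂ) (u : RapidityField ℂ) : φ (gFac q z u) = gFac q (φ ∘ z) (φ u) := by
  simp only [gFac, map_mul, map_prod, map_qbr, map_div₀, map_pow, map_inv₀, hφ, Function.comp_apply]

/-- `map_vNum` (technical). [folklore] -/
theorem map_vNum (z : Fin L → RapidityField ℂ) (a : Fin n → Fin L) (w : Fin n → RapidityField ℂ) :
    φ (vNum q z a w) = vNum q (φ ∘ z) a (φ ∘ w) := by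
  simp only [vNum, map_mul, map_prod, map_aFac hφ, map_eT hφ, map_gFac hφ, Function.comp_apply]

/-- `map_pref` (technical). [folklore] -/
theorem map_pref (z : Fin L → RapidityField ℂ) : φ (pref q z) = pref q (φ ∘ z) := by
  simp only [pref, map_mul, map_prod, map_qbr, map_div₀, map_pow, hφ, Function.comp_apply]

end Map

/-! ### Permuting the rapidities of two adjacent sites -/

section SwapSites

variable (q : ℂ) {s t : Fin L}

/-- A product over a `π`-invariant set of sites is unchanged by relabelling along `π`. [folklore] -/
theorem prod_filter_comp_perm {M : Type*} [CommMonoid M] (π : Equiv.Perm (Fin L)) (p : Fin L → Prop)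
    [DecidablePred p] (hp : ∀ j, p (π j) ↔ p j) (g : Fin L → M) :
    ∏ j ∈ univ.filter p, g (π j) = ∏ j ∈ univ.filter p, g j := by
  rw [prod_filter, prod_filter]
  calc (∏ j, if p j then g (π j) else 1) = ∏ j, (fun k => if p k then g k else 1) (π j) :=
        prod_congr rfl fun j _ => by simp only [hp j]
    _ = ∏ k, (fun k => if p k then g k else 1) k := Equiv.prod_comp π (fun k => if p k then g k else 1)

/-- `Ẽ_a` is unchanged by the transposition of the rapidities at `s, t = s+1` when `a ∉ {s, t}`.
[cite: HagendorfLienardy2021, Prop. 3.2 (Case 1)] -/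
theorem eT_comp_swap_of_ne (hst : t.val = s.val + 1) (z : Fin L → RapidityField ℂ) {a : Fin L}
    (has : a ≠ s) (hat : a ≠ t) (u : RapidityField ℂ) : eT q (z ∘ siteSwap s t) a u = eT q z a u := by
  unfold eT siteSwap
  congr 1
  · exact prod_filter_comp_perm (Equiv.swap s t) (fun j => a < j) (fun j => by
      rw [Equiv.swap_apply_def]; split_ifs with h1 h2 <;> simp only [Fin.lt_def, Fin.ext_iff] at * <;> omega)
      (fun j => qbr (z j / u))
  · exact prod_filter_comp_perm (Equiv.swap s t) (fun j => j < a) (fun j => by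
      rw [Equiv.swap_apply_def]; split_ifs with h1 h2 <;> simp only [Fin.lt_def, Fin.ext_iff] at * <;> omega)
      (fun j => qbr (genC ℂ q * z j / u))

/-- `G` is symmetric in the rapidities. [folklore] -/
theorem gFac_comp_perm (π : Equiv.Perm (Fin L)) (z : Fin L → RapidityField ℂ) (u : RapidityField ℂ) :
    gFac q (z ∘ π) u = gFac q z u := by
  unfold gFac
  simp only [Function.comp_apply]
  rw [Equiv.prod_comp π (fun j => qbr (genC ℂ q * z j / u)), Equiv.prod_comp π (fun j => qbr (genC ℂ q ^ 2 * u * z j))]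

/-- The common factor of `Ẽ_s`, `Ẽ_t`: `P(u) Q(u) = ∏_{j>t} [z_j/u] ∏_{j<s} [c z_j/u]`. [folklore] -/
def ePQ (z : Fin L → RapidityField ℂ) (s t : Fin L) (u : RapidityField ℂ) : RapidityField ℂ :=
  (∏ j ∈ univ.filter (fun j => t < j), qbr (z j / u)) * ∏ j ∈ univ.filter (fun j => j < s), qbr (genC ℂ q * z j / u)

/-- `filter_lt_s_eq` (technical). [folklore] -/
theorem filter_lt_s_eq (hst : t.val = s.val + 1) :
    univ.filter (fun j : Fin L => s < j) = insert t (univ.filter fun j => t < j) := by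
  ext j; simp only [mem_filter, mem_univ, true_and, mem_insert, Fin.lt_def, Fin.ext_iff]; omega

/-- `filter_gt_t_eq` (technical). [folklore] -/
theorem filter_gt_t_eq (hst : t.val = s.val + 1) :
    univ.filter (fun j : Fin L => j < t) = insert s (univ.filter fun j => j < s) := by
  ext j; simp only [mem_filter, mem_univ, true_and, mem_insert, Fin.lt_def, Fin.ext_iff]; omega

/-- `Ẽ_s(u) = [z_t/u] · PQ(u)`. [folklore] -/
theorem eT_left (hst : t.val = s.val + 1) (z : Fin L → RapidityField ℂ) (u : RapidityField ℂ) :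
    eT q z s u = qbr (z t / u) * ePQ q z s t u := by
  unfold eT ePQ
  rw [filter_lt_s_eq hst, prod_insert (by simp), mul_assoc]

/-- `Ẽ_t(u) = PQ(u) · [c z_s/u]`. [folklore] -/
theorem eT_right (hst : t.val = s.val + 1) (z : Fin L → RapidityField ℂ) (u : RapidityField ℂ) :
    eT q z t u = ePQ q z s t u * qbr (genC ℂ q * z s / u) := by
  unfold eT ePQ
  rw [filter_gt_t_eq hst, prod_insert (by simp)]; ring

/-- `PQ` is unchanged by the transposition of the rapidities at `s, t`. [folklore] -/
theorem ePQ_comp_swap (hst : t.val = s.val + 1) (z : Fin L → RapidityField ℂ) (u : RapidityField ℂ) :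
    ePQ q (z ∘ siteSwap s t) s t u = ePQ q z s t u := by
  unfold ePQ siteSwap
  congr 1
  · exact prod_filter_comp_perm (Equiv.swap s t) (fun j => t < j) (fun j => by
      rw [Equiv.swap_apply_def]; split_ifs with h1 h2 <;> simp only [Fin.lt_def, Fin.ext_iff] at * <;> omega)
      (fun j => qbr (z j / u))
  · exact prod_filter_comp_perm (Equiv.swap s t) (fun j => j < s) (fun j => by
      rw [Equiv.swap_apply_def]; split_ifs with h1 h2 <;> simp only [Fin.lt_def, Fin.ext_iff] at * <;> omega)
      (fun j => qbr (genC ℂ q * z j / u))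

/-- `Ẽ_s` after the transposition: `[z_s/u] · PQ(u)`. [folklore] -/
theorem eT_left_swap (hst : t.val = s.val + 1) (z : Fin L → RapidityField ℂ) (u : RapidityField ℂ) :
    eT q (z ∘ siteSwap s t) s u = qbr (z s / u) * ePQ q z s t u := by
  rw [eT_left q hst, ePQ_comp_swap q hst]
  simp [siteSwap, Equiv.swap_apply_right]

/-- `Ẽ_t` after the transposition: `PQ(u) · [c z_t/u]`. [folklore] -/
theorem eT_right_swap (hst : t.val = s.val + 1) (z : Fin L → RapidityField ℂ) (u : RapidityField ℂ) :
    eT q (z ∘ siteSwap s t) t u = ePQ q z s t u * qbr (genC ℂ q * z t / u) := by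
  rw [eT_right q hst, ePQ_comp_swap q hst]
  simp [siteSwap, Equiv.swap_apply_left]

/-- The prefactor after the transposition: `pref(z ∘ (s t)) · [c z_t/z_s] = pref(z) · [c z_s/z_t]`.
[cite: HagendorfLienardy2021, Prop. 3.2] -/
theorem pref_comp_swap (hst : t.val = s.val + 1) (z : Fin L → RapidityField ℂ) :
    pref q (z ∘ siteSwap s t) * qbr (genC ℂ q * z t / z s) = pref q z * qbr (genC ℂ q * z s / z t) := by
  unfold pref
  have h := prod_pairsLT_swap (M := RapidityField ℂ) hst
    (fun i j => qbr (genC ℂ q * z j / z i) * qbr (genC ℂ q ^ 2 * z i * z j))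
  simp only [siteSwap, Function.comp_apply] at h ⊢
  have e1 : qbr (genC ℂ q ^ 2 * z s * z t) = qbr (genC ℂ q ^ 2 * z t * z s) := by ring_nf
  rw [e1, ← mul_assoc, ← mul_assoc] at h
  by_cases h0 : qbr (genC ℂ q ^ 2 * z t * z s) = 0
  · -- degenerate (never happens for rapidities, but keeps the statement unconditional)
    have hmem : (s, t) ∈ pairsLT L := by rw [mem_pairsLT]; simp [Fin.lt_def, hst]
    rw [← mul_prod_erase _ _ hmem, ← mul_prod_erase _ _ hmem]
    simp only [Equiv.swap_apply_left, Equiv.swap_apply_right]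
    rw [show qbr (genC ℂ q ^ 2 * z s * z t) = 0 from e1.trans h0, h0]; ring
  · exact mul_right_cancel₀ h0 (by linear_combination h)

end SwapSites

/-! ### The four pointwise identities -/

section Cases

variable (q : ℂ) {s t : Fin L}

/-- **Case 1** (`s, t` both up, or both occupied by integration variables of other labels is excluded
by hypothesis): if no down spin sits at `s` or `t`, the numerator is symmetric under the transposition
of `z_s, z_t`. [cite: HagendorfLienardy2021, Prop. 3.2 (Case 1)] -/
theorem vNum_case1 (hst : t.val = s.val + 1) (z : Fin L → RapidityField ℂ) {a : Fin n → Fin L} (ha : ∀ ℓ, a ℓ ≠ s ∧ a ℓ ≠ t)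
    (w : Fin n → RapidityField ℂ) : vNum q (z ∘ siteSwap s t) a w = vNum q z a w := by
  unfold vNum
  congr 2
  · exact prod_congr rfl fun ℓ _ => eT_comp_swap_of_ne q hst z (ha ℓ).1 (ha ℓ).2 _
  · exact prod_congr rfl fun ℓ _ => gFac_comp_perm q _ z _

/-- The product of the `Ẽ`-factors with the factor `ℓ` singled out. [folklore] -/
theorem prod_eT_eq_mul_erase (z : Fin L → RapidityField ℂ) (a : Fin n → Fin L) (w : Fin n → RapidityField ℂ) (ℓ : Fin n) :
    ∏ k, eT q z (a k) (w k) = eT q z (a ℓ) (w ℓ) * ∏ k ∈ univ.erase ℓ, eT q z (a k) (w k) :=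
  (mul_prod_erase _ _ (mem_univ ℓ)).symm

/-- Away from the singled-out label the `Ẽ`-factors of `a` and of an update of `a` at `ℓ` agree. [folklore] -/
theorem prod_erase_eT_update (z : Fin L → RapidityField ℂ) (a : Fin n → Fin L) (w : Fin n → RapidityField ℂ)
    (ℓ : Fin n) (b : Fin L) :
    ∏ k ∈ univ.erase ℓ, eT q z (Function.update a ℓ b k) (w k) = ∏ k ∈ univ.erase ℓ, eT q z (a k) (w k) :=
  prod_congr rfl fun k hk => by rw [Function.update_of_ne (ne_of_mem_erase hk)]

/-- Away from the singled-out label (the only one at `s` or `t`) the `Ẽ`-factors are symmetric. [folklore] -/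
theorem prod_erase_eT_comp_swap (hst : t.val = s.val + 1) (z : Fin L → RapidityField ℂ) {a : Fin n → Fin L} (w : Fin n → RapidityField ℂ)
    {ℓ : Fin n} (ha : ∀ k, k ≠ ℓ → a k ≠ s ∧ a k ≠ t) :
    ∏ k ∈ univ.erase ℓ, eT q (z ∘ siteSwap s t) (a k) (w k) = ∏ k ∈ univ.erase ℓ, eT q z (a k) (w k) :=
  prod_congr rfl fun k hk => eT_comp_swap_of_ne q hst z (ha k (ne_of_mem_erase hk)).1 (ha k (ne_of_mem_erase hk)).2 _

/-- **Case 3** (down spin at `s`, up spin at `t`; `a' = a[ℓ ↦ t]`):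
`[c] N_a(w) + [z_s/z_t] N_{a'}(w) = [c z_s/z_t] N_a(w; z ∘ (s t))` whenever `w_ℓ ≠ 0`.
[cite: HagendorfLienardy2021, Prop. 3.2 (Case 3), (3.15)] -/
theorem vNum_case3 (hst : t.val = s.val + 1) (hq : q ≠ 0) (z : Fin L → RapidityField ℂ) (hz : ∀ j, z j ≠ 0) {a : Fin n → Fin L} {ℓ : Fin n}
    (hℓ : a ℓ = s) (ha : ∀ k, k ≠ ℓ → a k ≠ s ∧ a k ≠ t) (w : Fin n → RapidityField ℂ) (hw : w ℓ ≠ 0) :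
    qbr (genC ℂ q) * vNum q z a w + qbr (z s / z t) * vNum q z (Function.update a ℓ t) w =
      qbr (genC ℂ q * z s / z t) * vNum q (z ∘ siteSwap s t) a w := by
  unfold vNum
  rw [prod_eT_eq_mul_erase q z a w ℓ, prod_eT_eq_mul_erase q z (Function.update a ℓ t) w ℓ,
    prod_eT_eq_mul_erase q (z ∘ siteSwap s t) a w ℓ, prod_erase_eT_update, prod_erase_eT_comp_swap q hst z w ha,
    Function.update_self, hℓ, eT_left_swap q hst, eT_left q hst, eT_right q hst]
  rw [show (∏ k, gFac q (z ∘ siteSwap s t) (w k)) = ∏ k, gFac q z (w k) from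
    prod_congr rfl fun k _ => gFac_comp_perm q _ z _]
  have key := qbr_case3 (genC_ne_zero'' hq) (hz s) (hz t) hw (c := genC ℂ q)
  linear_combination (aFac q w * (ePQ q z s t (w ℓ) * (∏ k ∈ univ.erase ℓ, eT q z (a k) (w k)) *
    ∏ k, gFac q z (w k))) * key

/-- **Case 4** (up spin at `s`, down spin at `t`; `a'' = a[ℓ ↦ s]`):
`[c] N_a(w) + [z_s/z_t] N_{a''}(w) = [c z_s/z_t] N_a(w; z ∘ (s t))` whenever `w_ℓ ≠ 0`.
[cite: HagendorfLienardy2021, Prop. 3.2 (Case 4), (3.17)] -/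
theorem vNum_case4 (hst : t.val = s.val + 1) (hq : q ≠ 0) (z : Fin L → RapidityField ℂ) (hz : ∀ j, z j ≠ 0) {a : Fin n → Fin L} {ℓ : Fin n}
    (hℓ : a ℓ = t) (ha : ∀ k, k ≠ ℓ → a k ≠ s ∧ a k ≠ t) (w : Fin n → RapidityField ℂ) (hw : w ℓ ≠ 0) :
    qbr (genC ℂ q) * vNum q z a w + qbr (z s / z t) * vNum q z (Function.update a ℓ s) w =
      qbr (genC ℂ q * z s / z t) * vNum q (z ∘ siteSwap s t) a w := by
  unfold vNum
  rw [prod_eT_eq_mul_erase q z a w ℓ, prod_eT_eq_mul_erase q z (Function.update a ℓ s) w ℓ,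
    prod_eT_eq_mul_erase q (z ∘ siteSwap s t) a w ℓ, prod_erase_eT_update, prod_erase_eT_comp_swap q hst z w ha,
    Function.update_self, hℓ, eT_right_swap q hst, eT_left q hst, eT_right q hst]
  rw [show (∏ k, gFac q (z ∘ siteSwap s t) (w k)) = ∏ k, gFac q z (w k) from
    prod_congr rfl fun k _ => gFac_comp_perm q _ z _]
  have key := qbr_case4 (genC_ne_zero'' hq) (hz s) (hz t) hw (c := genC ℂ q)
  linear_combination (aFac q w * (ePQ q z s t (w ℓ) * (∏ k ∈ univ.erase ℓ, eT q z (a k) (w k)) *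
    ∏ k, gFac q z (w k))) * key

/-! #### Case 2 -/

variable {ℓ ℓ' : Fin n}

/-- `A(w ∘ (ℓ ℓ+1)) · F(w_ℓ, w_{ℓ+1}) = A(w) · F(w_{ℓ+1}, w_ℓ)`. [folklore] -/
theorem aFac_comp_swap (hℓℓ : ℓ'.val = ℓ.val + 1) (w : Fin n → RapidityField ℂ) :
    aFac q (w ∘ Equiv.swap ℓ ℓ') * aPair q (w ℓ) (w ℓ') = aFac q w * aPair q (w ℓ') (w ℓ) := by
  unfold aFac
  have h := prod_pairsLT_swap (M := RapidityField ℂ) hℓℓ (fun k k' => aPair q (w k) (w k'))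
  have h2 : (∏ k, qbr (genC ℂ q ^ 2 * (w ∘ Equiv.swap ℓ ℓ') k * (w ∘ Equiv.swap ℓ ℓ') k)) =
      ∏ k, qbr (genC ℂ q ^ 2 * w k * w k) := Equiv.prod_comp (Equiv.swap ℓ ℓ') (fun k => qbr (genC ℂ q ^ 2 * w k * w k))
  have h3 : (∏ k, ((w ∘ Equiv.swap ℓ ℓ') k)⁻¹) = ∏ k, (w k)⁻¹ := Equiv.prod_comp (Equiv.swap ℓ ℓ') (fun k => (w k)⁻¹)
  rw [h2, h3]
  simp only [Function.comp_apply]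
  linear_combination ((∏ k, qbr (genC ℂ q ^ 2 * w k * w k)) * ∏ k, (w k)⁻¹) * h

/-- `F(b, a) [c b/a] = -F(a, b) [c a/b]`. [folklore] -/
theorem aPair_antisymm (a b : RapidityField ℂ) :
    aPair q b a * qbr (genC ℂ q * b / a) = -(aPair q a b * qbr (genC ℂ q * a / b)) := by
  unfold aPair
  rw [qbr_div_rev a b, show genC ℂ q * b * a = genC ℂ q * a * b by ring,
    show genC ℂ q ^ 2 * b * a = genC ℂ q ^ 2 * a * b by ring]
  ring

/-- **`A(w) [c w_ℓ/w_{ℓ+1}]` is antisymmetric under `w_ℓ ↔ w_{ℓ+1}`** (at points where the pair factor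
does not vanish). [cite: HagendorfLienardy2021, Prop. 3.2 (Case 2)] -/
theorem aFac_mul_qbr_antisymm (hℓℓ : ℓ'.val = ℓ.val + 1) (w : Fin n → RapidityField ℂ) (hF : aPair q (w ℓ) (w ℓ') ≠ 0) :
    aFac q (w ∘ Equiv.swap ℓ ℓ') * qbr (genC ℂ q * (w ∘ Equiv.swap ℓ ℓ') ℓ / (w ∘ Equiv.swap ℓ ℓ') ℓ') =
      -(aFac q w * qbr (genC ℂ q * w ℓ / w ℓ')) := by
  simp only [Function.comp_apply, Equiv.swap_apply_left, Equiv.swap_apply_right]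
  have h := aFac_comp_swap q hℓℓ w
  have h2 := aPair_antisymm q (w ℓ) (w ℓ')
  apply mul_right_cancel₀ hF
  linear_combination qbr (genC ℂ q * w ℓ' / w ℓ) * h + aFac q w * h2

/-- **Case 2** (down spins at both `s = a_ℓ` and `t = a_{ℓ+1}`): the difference of the numerator after
and before the transposition of `z_s, z_t` is
`S(w) · [z_s/z_t] · A(w) [c w_ℓ/w_{ℓ+1}]` with `S` symmetric under `w_ℓ ↔ w_{ℓ+1}`.
[cite: HagendorfLienardy2021, Prop. 3.2 (Case 2), (3.14)] -/
theorem vNum_case2_diff (hst : t.val = s.val + 1) (hℓℓ : ℓ'.val = ℓ.val + 1) (hq : q ≠ 0) (z : Fin L → RapidityField ℂ) (hz : ∀ j, z j ≠ 0) {a : Fin n → Fin L}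
    (hℓs : a ℓ = s) (hℓt : a ℓ' = t) (ha : ∀ k, k ≠ ℓ → k ≠ ℓ' → a k ≠ s ∧ a k ≠ t)
    (w : Fin n → RapidityField ℂ) (hw : w ℓ ≠ 0) (hw' : w ℓ' ≠ 0) :
    vNum q (z ∘ siteSwap s t) a w - vNum q z a w =
      (aFac q w * qbr (genC ℂ q * w ℓ / w ℓ')) * (qbr (z s / z t) *
        ((ePQ q z s t (w ℓ) * ePQ q z s t (w ℓ')) *
          ((∏ k ∈ (univ.erase ℓ).erase ℓ', eT q z (a k) (w k)) * ∏ k, gFac q z (w k)))) := by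
  have hne : ℓ' ≠ ℓ := fun h => by rw [h] at hℓℓ; omega
  have hmem : ℓ' ∈ univ.erase ℓ := mem_erase.2 ⟨hne, mem_univ _⟩
  have split : ∀ z' : Fin L → RapidityField ℂ, ∏ k, eT q z' (a k) (w k) =
      eT q z' (a ℓ) (w ℓ) * (eT q z' (a ℓ') (w ℓ') * ∏ k ∈ (univ.erase ℓ).erase ℓ', eT q z' (a k) (w k)) := fun z' => by
    rw [← mul_prod_erase _ _ (mem_univ ℓ), ← mul_prod_erase _ _ hmem]
  have hrest : ∏ k ∈ (univ.erase ℓ).erase ℓ', eT q (z ∘ siteSwap s t) (a k) (w k) =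
      ∏ k ∈ (univ.erase ℓ).erase ℓ', eT q z (a k) (w k) :=
    prod_congr rfl fun k hk => by
      have h1 := ne_of_mem_erase hk
      have h2 := ne_of_mem_erase (mem_of_mem_erase hk)
      exact eT_comp_swap_of_ne q hst z (ha k h2 h1).1 (ha k h2 h1).2 _
  unfold vNum
  rw [split, split, hrest, hℓs, hℓt, eT_left_swap q hst, eT_right_swap q hst, eT_left q hst, eT_right q hst]
  rw [show (∏ k, gFac q (z ∘ siteSwap s t) (w k)) = ∏ k, gFac q z (w k) from
    prod_congr rfl fun k _ => gFac_comp_perm q _ z _]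
  have key := qbr_case2 (genC_ne_zero'' hq) (hz s) (hz t) hw hw' (c := genC ℂ q)
  linear_combination (aFac q w * (ePQ q z s t (w ℓ) * ePQ q z s t (w ℓ') *
    ((∏ k ∈ (univ.erase ℓ).erase ℓ', eT q z (a k) (w k)) * ∏ k, gFac q z (w k)))) * key

end Cases

/-! ### Residue sums: an antisymmetry criterion at the pole assignments -/

section ResSumPoles

/-- **A numerator antisymmetric in two integration variables at the pole assignments has residue sum
zero** (the hypothesis of `resSum_eq_zero_of_antisymm` is only needed at the points `w = z ∘ J`).
[cite: HagendorfLienardy2021, Prop. 3.2] -/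
theorem resSum_eq_zero_of_antisymm_poles (N : (Fin n → RapidityField ℂ) → RapidityField ℂ) {ℓ₁ ℓ₂ : Fin n}
    (hℓ : ℓ₁ ≠ ℓ₂)
    (hN : ∀ J : Fin n ↪ Fin L, N ((fun ℓ => zv (J ℓ)) ∘ Equiv.swap ℓ₁ ℓ₂) = -N (fun ℓ => zv (J ℓ))) :
    resSum L n N = 0 := by
  unfold resSum
  let τ : (Fin n ↪ Fin L) → (Fin n ↪ Fin L) := fun J => (Equiv.swap ℓ₁ ℓ₂).toEmbedding.trans J
  have hτ : ∀ J : Fin n ↪ Fin L, ∀ ℓ, τ J ℓ = J (Equiv.swap ℓ₁ ℓ₂ ℓ) := fun J ℓ => rfl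
  refine sum_involution (fun J _ => τ J) (fun J _ => ?_) (fun J _ _ h => ?_) (fun J _ => mem_univ _)
    (fun J _ => ?_)
  · have hw : (fun ℓ => zv (τ J ℓ)) = (fun ℓ => zv (J ℓ)) ∘ Equiv.swap ℓ₁ ℓ₂ := by
      funext ℓ; rw [hτ]; rfl
    have hprod : ∏ ℓ, resWeight L (τ J ℓ) = ∏ ℓ, resWeight L (J ℓ) := by
      simp_rw [hτ]
      exact Fintype.prod_equiv (Equiv.swap ℓ₁ ℓ₂) _ _ fun ℓ => rfl
    rw [hw, hN, hprod]; ring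
  · have h1 : τ J ℓ₁ = J ℓ₁ := by rw [h]
    rw [hτ, Equiv.swap_apply_left] at h1
    exact hℓ (J.injective h1).symm
  · ext ℓ
    rw [hτ, hτ, Equiv.swap_apply_self]

end ResSumPoles

/-! ### Nonvanishing of brackets of rapidities -/

section Nonvanishing

variable {q : ℂ}

/-- A quotient of polynomials whose values at `z ≡ 1` have different squares does not square to one.
[folklore] -/
theorem toRF_div_sq_ne_one {P Q : MvPolynomial ℕ ℂ} (hQ : toRF ℂ Q ≠ 0)
    (h : eval (fun _ => (1 : ℂ)) P ^ 2 ≠ eval (fun _ => (1 : ℂ)) Q ^ 2) : (toRF ℂ P / toRF ℂ Q) ^ 2 ≠ 1 := by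
  rw [div_pow, Ne, div_eq_one_iff_eq (pow_ne_zero _ hQ), ← map_pow (toRF ℂ) P 2, ← map_pow (toRF ℂ) Q 2]
  exact toRF_ne_of_eval (fun _ => (1 : ℂ)) (by rwa [eval_pow, eval_pow])

/-- `(c^e z_j / z_k)² ≠ 1` unless `c^{2e} = 1`: evaluation at `z ≡ 1`. [folklore] -/
theorem genC_pow_mul_zv_div_sq_ne_one {e : ℕ} (he : q ^ (2 * e) ≠ 1) (j k : Fin L) :
    (genC ℂ q ^ e * zv j / zv k) ^ 2 ≠ 1 := by
  have hrepr : genC ℂ q ^ e * zv j / zv k = toRF ℂ (C q ^ e * X (j.val + 1)) / toRF ℂ (X (k.val + 1)) := by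
    simp only [genC, zv, genZ, map_mul, map_pow]
  rw [hrepr]
  refine toRF_div_sq_ne_one (genZ_ne_zero _) ?_
  simp only [eval_mul, eval_pow, eval_C, eval_X, mul_one, one_pow, ← pow_mul]
  rwa [mul_comm] at he

/-- `(c^e z_j z_k)² ≠ 1` unless `c^{2e} = 1`: evaluation at `z ≡ 1`. [folklore] -/
theorem genC_pow_mul_zv_mul_sq_ne_one {e : ℕ} (he : q ^ (2 * e) ≠ 1) (u v : Fin L) :
    (genC ℂ q ^ e * zv u * zv v) ^ 2 ≠ 1 := by
  have hrepr : genC ℂ q ^ e * zv u * zv v = toRF ℂ (C q ^ e * X (u.val + 1) * X (v.val + 1)) / toRF ℂ 1 := by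
    simp only [genC, zv, genZ, map_mul, map_pow, map_one, div_one]
  rw [hrepr]
  refine toRF_div_sq_ne_one (by rw [map_one]; exact one_ne_zero) ?_
  simp only [eval_mul, eval_pow, eval_C, eval_X, mul_one, one_pow, map_one, ← pow_mul]
  rwa [mul_comm] at he

variable (hq : q ^ 2 + q + 1 = 0)
include hq

/-- `q_sq_ne_one'` (technical). [folklore] -/
theorem q_sq_ne_one' : q ^ (2 * 1) ≠ 1 := by
  rw [mul_one]; exact sq_ne_one_of_quad'' hq

/-- `q_pow_four_ne_one` (technical). [folklore] -/
theorem q_pow_four_ne_one : q ^ (2 * 2) ≠ 1 := by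
  have h3 : q ^ 3 = 1 := by linear_combination (q - 1) * hq
  rw [show q ^ (2 * 2) = q ^ 3 * q by ring, h3, one_mul]
  rintro rfl; norm_num at hq

/-- `[c z_j/z_k] ≠ 0`. [folklore] -/
theorem qbr_genC_zv_div_ne_zero (j k : Fin L) : qbr (genC ℂ q * zv j / zv k) ≠ 0 := by
  have := genC_pow_mul_zv_div_sq_ne_one (L := L) (q_sq_ne_one' hq) j k
  rw [pow_one] at this
  exact qbr_ne_zero_of_sq_ne_one (div_ne_zero (mul_ne_zero (genC_ne_zero'' (ne_zero_of_quad hq)) (zv_ne_zero _))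
    (zv_ne_zero _)) this

/-- `[c z_j z_k] ≠ 0`. [folklore] -/
theorem qbr_genC_zv_mul_ne_zero (j k : Fin L) : qbr (genC ℂ q * zv j * zv k) ≠ 0 := by
  have := genC_pow_mul_zv_mul_sq_ne_one (L := L) (q_sq_ne_one' hq) j k
  rw [pow_one] at this
  exact qbr_ne_zero_of_sq_ne_one (mul_ne_zero (mul_ne_zero (genC_ne_zero'' (ne_zero_of_quad hq)) (zv_ne_zero _))
    (zv_ne_zero _)) this

/-- `[c² z_j z_k] ≠ 0`. [folklore] -/
theorem qbr_genC_sq_zv_mul_ne_zero (j k : Fin L) : qbr (genC ℂ q ^ 2 * zv j * zv k) ≠ 0 :=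
  qbr_ne_zero_of_sq_ne_one (mul_ne_zero (mul_ne_zero (pow_ne_zero _ (genC_ne_zero'' (ne_zero_of_quad hq))) (zv_ne_zero _))
    (zv_ne_zero _)) (genC_pow_mul_zv_mul_sq_ne_one (q_pow_four_ne_one hq) j k)

/-- `[c] ≠ 0`. [folklore] -/
theorem qbr_genC_ne_zero : qbr (genC ℂ q) ≠ 0 := by
  refine qbr_ne_zero_of_sq_ne_one (genC_ne_zero'' (ne_zero_of_quad hq)) ?_
  have hrepr : genC ℂ q = toRF ℂ (C q) / toRF ℂ 1 := by simp only [genC, map_one, div_one]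
  rw [hrepr]
  refine toRF_div_sq_ne_one (by rw [map_one]; exact one_ne_zero) ?_
  simpa using sq_ne_one_of_quad'' hq

/-- The pair factor does not vanish at two distinct rapidities. [folklore] -/
theorem aPair_zv_ne_zero {j k : Fin L} (hjk : j ≠ k) : aPair q (zv j) (zv k) ≠ 0 := by
  unfold aPair
  refine mul_ne_zero (mul_ne_zero (mul_ne_zero ?_ (qbr_zv_div_ne_zero hjk)) (qbr_genC_zv_mul_ne_zero hq j k))
    (qbr_genC_sq_zv_mul_ne_zero hq j k)
  exact qbr_genC_zv_div_ne_zero hq k j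

end Nonvanishing

/-! ### The exchange relations of the components -/

section Exchange

variable {q : ℂ} (hq : q ^ 2 + q + 1 = 0) {s t : Fin L} (hst : t.val = s.val + 1)
include hq hst

/-- The swap automorphism on a component: `σ_s Ψ_a = [c]ⁿ pref(z ∘ (s t)) resSum N_a(·; z ∘ (s t))`.
[cite: HagendorfLienardy2021, Prop. 3.2] -/
theorem genSwap_vPsi (a : Fin n → Fin L) :
    genSwap ℂ (s.val + 1) (vPsi q L n a) =
      qbr (genC ℂ q) ^ n * pref q (zv ∘ siteSwap s t) * resSum L n (vNum q (zv ∘ siteSwap s t) a) := by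
  have _ := hq
  unfold vPsi
  have hz : (genSwap ℂ (s.val + 1) : RapidityField ℂ →+* RapidityField ℂ) ∘ zv = zv ∘ siteSwap s t := by
    funext j; exact genSwap_zv hst j
  rw [map_mul, map_mul, map_pow, genSwap_qbr', genSwap_genC',
    show genSwap ℂ (s.val + 1) (pref q zv) = pref q (zv ∘ siteSwap s t) from by
      rw [← hz]; exact map_pref (φ := (genSwap ℂ (s.val + 1) : RapidityField ℂ →+* RapidityField ℂ)) (genSwap_genC' _ q) zv,
    genSwap_resSum hst (vNum q zv a) (vNum q (zv ∘ siteSwap s t) a) fun w => by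
      rw [← hz]; exact map_vNum (φ := (genSwap ℂ (s.val + 1) : RapidityField ℂ →+* RapidityField ℂ)) (genSwap_genC' _ q) zv a w]

/-- From the invariance of the residue sum to the exchange relation with equal spins. [folklore] -/
theorem vPsi_exchange_of_resSum_eq {a : Fin n → Fin L}
    (h : resSum L n (vNum q (zv ∘ siteSwap s t) a) = resSum L n (vNum q zv a)) :
    qbr (genC ℂ q * zv t / zv s) * genSwap ℂ (s.val + 1) (vPsi q L n a) = qbr (genC ℂ q * zv s / zv t) * vPsi q L n a := by
  rw [genSwap_vPsi hq hst, h]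
  unfold vPsi
  have hp := pref_comp_swap q hst zv
  linear_combination (qbr (genC ℂ q) ^ n * resSum L n (vNum q zv a)) * hp

/-- **Exchange relation, equal spins at `s, t = s+1`** (both up: no `a_ℓ` there; both down:
`a_ℓ = s, a_{ℓ+1} = t`): `[c z_t/z_s] σ_s Ψ_a = [c z_s/z_t] Ψ_a`, i.e. HL (3.13)
`Ψ_a(…, z_t, z_s, …) = ([q z_s/z_t]/[q z_t/z_s]) Ψ_a`. [cite: HagendorfLienardy2021, Prop. 3.2 (Cases 1, 2), (3.13)] -/
theorem vPsi_exchange_same {a : Fin n → Fin L}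
    (ha : (∀ ℓ, a ℓ ≠ s ∧ a ℓ ≠ t) ∨
      ∃ ℓ ℓ' : Fin n, ℓ'.val = ℓ.val + 1 ∧ a ℓ = s ∧ a ℓ' = t ∧ ∀ k, k ≠ ℓ → k ≠ ℓ' → a k ≠ s ∧ a k ≠ t) :
    qbr (genC ℂ q * zv t / zv s) * genSwap ℂ (s.val + 1) (vPsi q L n a) = qbr (genC ℂ q * zv s / zv t) * vPsi q L n a := by
  refine vPsi_exchange_of_resSum_eq hq hst ?_
  rcases ha with ha | ⟨ℓ, ℓ', hℓℓ, hℓs, hℓt, ha⟩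
  · exact resSum_congr fun J => vNum_case1 q hst zv ha _
  · rw [← sub_eq_zero, ← resSum_sub]
    have hne : ℓ ≠ ℓ' := fun h => by rw [h] at hℓℓ; omega
    refine resSum_eq_zero_of_antisymm_poles _ hne fun J => ?_
    have hq0 := ne_zero_of_quad hq
    have hJ : ∀ k, ((fun ℓ => zv (J ℓ)) ∘ Equiv.swap ℓ ℓ') k ≠ 0 := fun k => zv_ne_zero _
    rw [vNum_case2_diff q hst hℓℓ hq0 zv zv_ne_zero hℓs hℓt ha _ (hJ ℓ) (hJ ℓ'),
      vNum_case2_diff q hst hℓℓ hq0 zv zv_ne_zero hℓs hℓt ha (fun k => zv (J k)) (zv_ne_zero _) (zv_ne_zero _),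
      aFac_mul_qbr_antisymm q hℓℓ (fun k => zv (J k)) (aPair_zv_ne_zero hq (fun h => hne (J.injective h)))]
    have hsym1 : ∏ k ∈ (univ.erase ℓ).erase ℓ', eT q zv (a k) (((fun ℓ => zv (J ℓ)) ∘ Equiv.swap ℓ ℓ') k) =
        ∏ k ∈ (univ.erase ℓ).erase ℓ', eT q zv (a k) (zv (J k)) :=
      prod_congr rfl fun k hk => by
        rw [Function.comp_apply, Equiv.swap_apply_of_ne_of_ne (ne_of_mem_erase (mem_of_mem_erase hk)) (ne_of_mem_erase hk)]
    have hsym2 : ∏ k, gFac q (zv : Fin L → RapidityField ℂ) (((fun ℓ => zv (J ℓ)) ∘ Equiv.swap ℓ ℓ') k) =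
        ∏ k, gFac q (zv : Fin L → RapidityField ℂ) (zv (J k)) :=
      Equiv.prod_comp (Equiv.swap ℓ ℓ') (fun k => gFac q (zv : Fin L → RapidityField ℂ) (zv (J k)))
    rw [hsym1, hsym2]
    simp only [Function.comp_apply, Equiv.swap_apply_left, Equiv.swap_apply_right]
    ring

/-- **Exchange relation, down spin at `s` and up spin at `t = s+1`**: with `a ℓ = s` and
`a' = a[ℓ ↦ t]`, `[c] Ψ_a + [z_s/z_t] Ψ_{a'} = [c z_t/z_s] σ_s Ψ_a`, i.e. HL (3.16).
[cite: HagendorfLienardy2021, Prop. 3.2 (Case 3), (3.16)] -/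
theorem vPsi_exchange_move_right {a : Fin n → Fin L} {ℓ : Fin n} (hℓ : a ℓ = s)
    (ha : ∀ k, k ≠ ℓ → a k ≠ s ∧ a k ≠ t) :
    qbr (genC ℂ q) * vPsi q L n a + qbr (zv s / zv t) * vPsi q L n (Function.update a ℓ t) =
      qbr (genC ℂ q * zv t / zv s) * genSwap ℂ (s.val + 1) (vPsi q L n a) := by
  rw [genSwap_vPsi hq hst]
  have hsum : resSum L n (fun w => qbr (genC ℂ q * zv s / zv t) * vNum q (zv ∘ siteSwap s t) a w) =
      resSum L n (fun w => qbr (genC ℂ q) * vNum q zv a w + qbr (zv s / zv t) * vNum q zv (Function.update a ℓ t) w) :=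
    resSum_congr fun J => (vNum_case3 q hst (ne_zero_of_quad hq) zv zv_ne_zero hℓ ha (fun k => zv (J k)) (zv_ne_zero _)).symm
  rw [resSum_mul_left, resSum_add, resSum_mul_left, resSum_mul_left] at hsum
  unfold vPsi
  have hp := pref_comp_swap q hst zv
  linear_combination (-(qbr (genC ℂ q) ^ n * pref q zv)) * hsum -
    (qbr (genC ℂ q) ^ n * resSum L n (vNum q (zv ∘ siteSwap s t) a)) * hp

/-- **Exchange relation, up spin at `s` and down spin at `t = s+1`**: with `a ℓ = t` and
`a'' = a[ℓ ↦ s]`, `[c] Ψ_a + [z_s/z_t] Ψ_{a''} = [c z_t/z_s] σ_s Ψ_a`, i.e. HL (3.17).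
[cite: HagendorfLienardy2021, Prop. 3.2 (Case 4), (3.17)] -/
theorem vPsi_exchange_move_left {a : Fin n → Fin L} {ℓ : Fin n} (hℓ : a ℓ = t)
    (ha : ∀ k, k ≠ ℓ → a k ≠ s ∧ a k ≠ t) :
    qbr (genC ℂ q) * vPsi q L n a + qbr (zv s / zv t) * vPsi q L n (Function.update a ℓ s) =
      qbr (genC ℂ q * zv t / zv s) * genSwap ℂ (s.val + 1) (vPsi q L n a) := by
  rw [genSwap_vPsi hq hst]
  have hsum : resSum L n (fun w => qbr (genC ℂ q * zv s / zv t) * vNum q (zv ∘ siteSwap s t) a w) =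
      resSum L n (fun w => qbr (genC ℂ q) * vNum q zv a w + qbr (zv s / zv t) * vNum q zv (Function.update a ℓ s) w) :=
    resSum_congr fun J => (vNum_case4 q hst (ne_zero_of_quad hq) zv zv_ne_zero hℓ ha (fun k => zv (J k)) (zv_ne_zero _)).symm
  rw [resSum_mul_left, resSum_add, resSum_mul_left, resSum_mul_left] at hsum
  unfold vPsi
  have hp := pref_comp_swap q hst zv
  linear_combination (-(qbr (genC ℂ q) ^ n * pref q zv)) * hsum -
    (qbr (genC ℂ q) ^ n * resSum L n (vNum q (zv ∘ siteSwap s t) a)) * hp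

end Exchange

end Literature.Probability.Percolation
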